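import Literature.MathematicalPhysics.QuantumFieldTheory.Balaban1983to89.T4FiniteEpsInhabitedB
import Literature.MathematicalPhysics.QuantumFieldTheory.Balaban1983to89.T4ApexHybrid

/-!
# What the SPINE LEAF asks at the flat datum of record: the Stage-0 reading of «B5 = `HybridNE7Under`» in kernel form
# (director-ym LINE №16 (4) «is `…BalabanLadder.UV` junk-inhabitable?»; chair R432 (B)(5))

HONEST FRAMING.  Kernel bookkeeping about the TYPES; nothing of Bałaban's asserted; one finite four-torus family at fixed ε; nothing
continuum ∕ ℝ⁴ ∕ OS ∕ mass gap ∕ Clay.  Unit `pub-ymgap-dag-n13-b` (HUMAN RULING D-0062; rev-1 kernel tester for the A4 vacuity repair,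
dag-lead REBALANCE-8-N13B).  Companion of `T4FiniteEpsInhabitedB` (the flat datum: `Sect2Form := True`, `χ := 0`, mass-flattening `R`,
constant flows) and of `Node00.N23Dossier`.

THE QUESTION.  The spine leaf `Summit.QuantumFields.YangMills.Theses.BalabanLadder.UV` (route `route-QuantumFields-BalabanLadder`,
item stmt-QuantumFields-19351) reads, per family `F`:
`∃ D : FiniteEpsData F SU(2), Node00.IsDatumOfRecord₀ F 2 D ∧ B16.EndStatementBPrinted D.C ∧ DagBinding.EndpointExistence D.C.toB12 ∧
   T4ApexHybrid.HybridNE7Under D (DagBinding.EndpointExistence D.C.toB12)`.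
The first three conjuncts HOLD at the flat datum (`T4FiniteEpsInhabitedB.exists_isDatumOfRecord₀_endStatementBPrinted_endpoint`).  The fourth
is `D.UnderHypotheses Hβ (fun g₀ => StringwiseHybridNE7 (D.scheme g₀))` (T4ApexHybrid :165), whose prefix `UnderHypotheses`
(T4Continuum :1055) quantifies over the bare-coupling sequences `g₀` TUNED to the renormalised coupling `g` THROUGH `D.C`'s flows
(`FiniteEpsData.Tuned`, :866), and whose matrix reads ONLY the genuine Wilson scheme `D.scheme g₀` (:856: the lattices of `F`, the inverse
couplings `(g₀ K)⁻²`, the averaged loop observables along `D.av`).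

THE ANSWER (kernel, this file).  At the flat datum the tuned sequences are EXACTLY THE CONSTANTS (`tuned_flatData_iff`: `Tuned γ g g₀ ↔
(∀ K, g₀ K = g) ∧ 0 < g ≤ γ` — constant flows), so the prefix collapses (`underHypotheses_flatData_iff`) and
  `HybridNE7Under (flatData …) Hβ  ↔  (Hβ → ∃ g₁ > 0, ∀ g ∈ ]0, g₁], StringwiseHybridNE7 ((flatData …).scheme (fun _ => g)))`
(`hybridNE7Under_flatData_iff`) — hybrid NE7 for WILSON'S THEORY AT EVERY SUFFICIENTLY SMALL **CONSTANT** BARE COUPLING (no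
renormalisation: `β_K = g⁻²` for all `K`), observables averaged along the averaging of record.  Consequently
(`spineShape_of_constCouplingNE7`): for every `N ≥ 1`, the N-generic body of the spine leaf at `F` FOLLOWS from that constant-coupling
statement ALONE — a statement with NO Bałaban content (no β-function, no (B), no `R`).  VERDICT FOR №16 (4), as far as the kernel speaks:
the leaf is NOT junk-inhabitable by type-level freedom (its fourth conjunct is a genuine statement about `Missing.expect`), BUT as typed it is
implied by «hybrid NE7 at constant small bare coupling», because `Tuned` reads the FREE flows of `D.C`; pinning the β-functions (Stage 5∕8,
R432 (B)(3)) makes the tuned sequences Bałaban's `g₀(ε, g)` and removes this reading.  Whether the constant-coupling statement is true,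
false or open is NOT addressed here (physics remark, labelled: at fixed bare coupling the `ε → 0` limit of fixed physical loops is the
trivial short-distance regime; the hybrid-NE7 package asks for more than convergence).

WHAT THIS FILE PROVES (zero `sorry`, axioms standard; BY NAME over `T4FiniteEpsInhabitedB.flatData ∕ flatDataOfRecord`,
`T4Continuum.FiniteEpsData.Tuned ∕ UnderHypotheses ∕ scheme`, `T4ApexHybrid.HybridNE7Under ∕ StringwiseHybridNE7`):
`tuned_flatData_iff`, `underHypotheses_flatData_iff`, `hybridNE7Under_flatData_iff`, `scheme_flatData_eq_of_av` (the flat scheme is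
the scheme of EVERY datum with the same averaging), `spineShape_of_constCouplingNE7` (SU(N), Stage 0 record).  NOT a proof or refutation of
the leaf; nothing is filed against the Summits decl.
-/

noncomputable section

namespace Literature.MathematicalPhysics.QuantumFieldTheory.Balaban1983to89.T4FiniteEpsInhabitedBSpine

open Literature.MathematicalPhysics.QuantumFieldTheory.Balaban1983to89
open T4Continuum T4ApexHybrid T4FiniteEpsInhabited T4FiniteEpsInhabitedB AveragingRT

section Flat

variable {F : T4Family} {G : Type} [GaugeGroup G] [MeasurableSpace G] [HaarData G] [RegularGaugeGroup G]
  (av : (K j : ℕ) → Averaging (F.P K) j G)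
  (hmeas : ∀ K j, Measurable (av K j).avg) (hac : ∀ K k, k < K → HaarAC (av K k).avg)

/-- **At the flat datum the tuned bare-coupling sequences are the constants**: `Tuned γ g g₀ ↔ (∀ K, g₀ K = g) ∧ 0 < g ∧ g ≤ γ`
(constant flows `g_k = g₀ K` of every run). [cite: Balaban1987RG1, Thm 2 p.259 (the tuning «g₀ = g₀(ε, g) … g_K = g» typed as `FiniteEpsData.Tuned`, read at the constant-flow placeholder — bookkeeping, not a statement about the paper)] -/
theorem tuned_flatData_iff {γ g : ℝ} {g₀ : ℕ → ℝ} :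
    (flatData F G av hmeas hac).Tuned γ g g₀ ↔ (∀ K, g₀ K = g) ∧ 0 < g ∧ g ≤ γ := by
  constructor
  · intro h
    have hK : ∀ K, g₀ K = g := fun K => (h K).2
    have h0 := (h 0).1 0 le_rfl
    refine ⟨hK, ?_, ?_⟩
    · rw [← hK 0]; exact h0.1
    · rw [← hK 0]; exact h0.2
  · rintro ⟨hK, hg, hgγ⟩ K
    refine ⟨fun k _ => ?_, hK K⟩
    show 0 < g₀ K ∧ g₀ K ≤ γ
    rw [hK K]; exact ⟨hg, hgγ⟩

/-- **The prefix `UnderHypotheses` collapses at the flat datum**: its (B)-antecedent holds (`endStatementBPrinted_flat`), and the tuned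
sequences are the constants, so `UnderHypotheses Hβ concl ↔ (Hβ → ∃ g₁ > 0, ∀ g ∈ ]0, g₁], concl (fun _ => g))`.
[cite: Balaban1987RG1, Thm 2 p.259 (the quantifier prefix «γ small, then g small, then every tuned g₀» typed as `UnderHypotheses`, read at the placeholder — bookkeeping)] -/
theorem underHypotheses_flatData_iff (Hβ : Prop) (concl : (ℕ → ℝ) → Prop) :
    (flatData F G av hmeas hac).UnderHypotheses Hβ concl ↔
      (Hβ → ∃ g₁ : ℝ, 0 < g₁ ∧ ∀ g : ℝ, 0 < g → g ≤ g₁ → concl (fun _ => g)) := by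
  constructor
  · intro h hβ
    obtain ⟨γ₀, hγ₀, H⟩ := h (endStatementBPrinted_flat F G av hmeas hac) hβ
    obtain ⟨g₁, hg₁, Hg⟩ := H γ₀ hγ₀ le_rfl
    refine ⟨min g₁ γ₀, lt_min hg₁ hγ₀, fun g hg hgle => ?_⟩
    exact Hg g hg (hgle.trans (min_le_left _ _)) (fun _ => g)
      ((tuned_flatData_iff av hmeas hac).mpr ⟨fun _ => rfl, hg, hgle.trans (min_le_right _ _)⟩)
  · intro h _ hβ
    obtain ⟨g₁, hg₁, Hg⟩ := h hβ
    refine ⟨1, one_pos, fun γ _ _ => ⟨g₁, hg₁, fun g hg hgle g₀ ht => ?_⟩⟩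
    obtain ⟨hK, -, -⟩ := (tuned_flatData_iff av hmeas hac).mp ht
    have : g₀ = fun _ => g := funext hK
    rw [this]
    exact Hg g hg hgle

/-- **The spine binder B5 at the flat datum, in closed form**: `HybridNE7Under (flatData …) Hβ ↔ (Hβ → hybrid NE7, string by string, for the
GENUINE Wilson scheme at every sufficiently small CONSTANT bare coupling)`. [cite: Balaban1989LargeFieldII, Thm 1 + (0.1) pp.355–356 (the spine's «under (B)» prefix read at the Stage-0 placeholder — bookkeeping, not a statement about the paper)] -/
theorem hybridNE7Under_flatData_iff (Hβ : Prop) :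
    HybridNE7Under (flatData F G av hmeas hac) Hβ ↔
      (Hβ → ∃ g₁ : ℝ, 0 < g₁ ∧ ∀ g : ℝ, 0 < g → g ≤ g₁ →
        StringwiseHybridNE7 ((flatData F G av hmeas hac).scheme (fun _ => g))) :=
  underHypotheses_flatData_iff av hmeas hac Hβ _

omit [RegularGaugeGroup G] in
/-- The flat datum's Wilson scheme is the scheme of EVERY datum with the same averaging maps (the scheme reads `F`, `g₀` and `D.av` only).
[cite: JaffeWittenClay2006, §6.5 p.11 (the finite-ε expectations; bookkeeping identity)] -/
theorem scheme_eq_of_av_eq (D D' : FiniteEpsData F G) (h : D.av = D'.av) (g₀ : ℕ → ℝ) : D.scheme g₀ = D'.scheme g₀ := by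
  unfold FiniteEpsData.scheme FiniteEpsData.avgObs
  rw [h]

end Flat

/-! ## At the record (Stage 0), `SU(N)`: the leaf's N-generic body from the constant-coupling statement alone -/

section Record

variable (F : T4Family) (N : ℕ) [NeZero N]

/-- Endpoint existence AS TYPED at the flat datum of record (constant flows; the twin of `T4FiniteEpsInhabitedB` v2's
`endpointExistence_flat`, restated locally so that this file depends on v1 only). [cite: Balaban1987RG1, Thm 2 p.259 (typed form `DagBinding.EndpointExistence` HOLDS VACUOUSLY at the constant-flow placeholder — bookkeeping, not a statement about the paper)] -/
theorem endpointExistence_flatDataOfRecord : DagBinding.EndpointExistence (flatDataOfRecord F N).C.toB12 :=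
  fun _ => ⟨1, one_pos, fun γ hγ _ => ⟨γ, hγ, fun g hg hgγ _ => ⟨g, fun _ _ => ⟨hg, hgγ⟩, rfl⟩⟩⟩

/-- **THE SPINE LEAF'S BODY AT `F` FOLLOWS FROM «HYBRID NE7 AT CONSTANT SMALL BARE COUPLING» ALONE** (N-generic; at `N = 2` the conclusion is,
word for word, the matrix of `Summit.QuantumFields.YangMills.Theses.BalabanLadder.UV` at `F`): the flat datum of record carries the first three
conjuncts vacuously and turns the fourth into the hypothesis.  The hypothesis mentions NO construction, NO β-function, NO (B): it is a
statement about `Missing.expect` of Wilson's `SU(N)` theory with `β_K = g⁻²` CONSTANT in `K` and the loop observables averaged along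
`Node00.avOfRecord`.  This is the exact sense in which the leaf «as typed» under-pins the datum (R432 (B)(5)); pinning `βfun` at Stage 5∕8 removes it.
[cite: Balaban1989LargeFieldII, Thm 1 + (0.1) pp.355–356 (regression certificate for the typed reading of the spine leaf at Stage 0; bookkeeping, not a statement about the paper)] -/
theorem spineShape_of_constCouplingNE7
    (h : ∃ g₁ : ℝ, 0 < g₁ ∧ ∀ g : ℝ, 0 < g → g ≤ g₁ →
      StringwiseHybridNE7 ((flatDataOfRecord F N).scheme (fun _ => g))) :
    ∃ D : FiniteEpsData F (Matrix.specialUnitaryGroup (Fin N) ℂ),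
      Node00.IsDatumOfRecord₀ F N D ∧ B16.EndStatementBPrinted D.C ∧ DagBinding.EndpointExistence D.C.toB12 ∧
        HybridNE7Under D (DagBinding.EndpointExistence D.C.toB12) :=
  ⟨flatDataOfRecord F N, isDatumOfRecord₀_flatDataOfRecord F N, endStatementBPrinted_flatDataOfRecord F N,
    endpointExistence_flatDataOfRecord F N,
    (hybridNE7Under_flatData_iff (Node00.avOfRecord F N) (Node00.avOfRecord_measurable F N) (Node00.avOfRecord_haarAC F N) _).mpr
      fun _ => h⟩

/-- Conversely, the fourth conjunct AT the flat datum of record gives back the constant-coupling statement (the endpoint antecedent holds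
there): the reading is EXACT. [cite: Balaban1989LargeFieldII, Thm 1 + (0.1) pp.355–356 (bookkeeping, converse direction)] -/
theorem constCouplingNE7_of_hybridNE7Under_flat
    (h : HybridNE7Under (flatDataOfRecord F N) (DagBinding.EndpointExistence (flatDataOfRecord F N).C.toB12)) :
    ∃ g₁ : ℝ, 0 < g₁ ∧ ∀ g : ℝ, 0 < g → g ≤ g₁ → StringwiseHybridNE7 ((flatDataOfRecord F N).scheme (fun _ => g)) :=
  (hybridNE7Under_flatData_iff (Node00.avOfRecord F N) (Node00.avOfRecord_measurable F N) (Node00.avOfRecord_haarAC F N) _).mp h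
    (endpointExistence_flatDataOfRecord F N)

end Record

end Literature.MathematicalPhysics.QuantumFieldTheory.Balaban1983to89.T4FiniteEpsInhabitedBSpine

end
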